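import Literature.AlgebraicGeometry.ShimuraVarieties.UnitaryShimuraCurveWeakCanonicalUnique
import Literature.AlgebraicGeometry.Motives.BaseChangeComplexPointsAlong
import HarnessLib

/-!
# The base change `M_K ⊗_L E′` of a canonical-model record of the unitary Shimura CURVE is a WEAK record over `E′`
# (points and reciprocity inherited) — the `Y`-input of ★ `UnitaryShimuraCurveWeakCanonicalUnique` ([Deligne 1979] 2.2.6)

Topic `AlgebraicGeometry/ShimuraVarieties`, namespace `…ShimuraVarieties.UnitaryCanonicalModel`.  THEOREMS ONLY (no definition, no
instance, no notation, no named fact, no `sorry`).  Cell `hodgecm-mathlib` (D-0151), programme P6 «MOD» (crux hLiu418 =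
stmt-HodgeConjecture-24832, `--supports`), GEN letter `stub_UNIQ`∕`stub_UNIF`: ★ `WeakRecordGS.exists_iso_of_complexIso` (p845822) identifies
two WEAK records over `E′ ⊇ L`; GEN՚s moduli side supplies `X` (the RSZ generic fibre over `Fᵢ`), and THIS file supplies the record side
`Y := (S.M K) ⊗_L E′` for `S : RecordSystemGS L J⋆ τ K₀`: its complex points along `τ′` are `Sh_K(ℂ)` (`ptsY`, through ★
`exists_homeomorph_complexPoints_baseChange` and `S.pts K`), Shimura reciprocity at the diagonal CM pairs holds for every `σ ∈ Aut(ℂ∕τ′E′)`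
(`recipY`, from `S.recip K` at `σ|` and the Galois equivariance ★ `smul_eq_of_left_comp_fst`), and its complex fibre along `τ′` is the complex
fibre of `M_K` along `τ` compatibly with the points (`gY`, ★ `exists_iso_baseChangeHom_baseChange`) — so GEN builds the comparison `gc` of
`exists_iso_of_complexIso` from `S`՚s own complex data (★ (F2c) `pieces`).  HONEST LABEL: HC_CM is proved only modulo the 2 remaining named
inputs (hLiu418 24832, h413 24833) until rung 0 closes; this file is count-neutral capital.

* **`RecordSystemGS.exists_weakRecord_baseChange`** — `∃ ptsY : (M_K ⊗_L E′)_{τ′}(ℂ) ≃ₜ Sh_K(ℂ)`, weak reciprocity for `Aut(ℂ∕τ′E′)`, and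
  `∃ gY : (M_K ⊗_L E′) ⊗_{τ′} ℂ ≅ M_K ⊗_τ ℂ` over `ℂ` with `gY (bce_{τ′} (ptsY⁻¹[v,aK])) = bce_τ ((S.pts K)⁻¹[v,aK])`.

## References
* [Deligne1979ShimuraVarieties] P. Deligne, *Variétés de Shimura* (1979), 2.2.4–2.2.6.
* [Milne2005ShimuraVarieties] J. S. Milne, *Introduction to Shimura varieties* (2005), Def. 12.8 (62) p. 114, Prop. 13.1 p. 117, Thm. 13.7 p. 119.
* [GortzWedhorn2020] U. Görtz, T. Wedhorn, *Algebraic Geometry I* (2020), Prop. 4.16, §(4.7)–(4.9).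
-/

set_option autoImplicit false

noncomputable section

open Function MulAction Topology NumberField IsDedekindDomain CategoryTheory CategoryTheory.Limits Matrix
  AlgebraicGeometry
open scoped Matrix ComplexOrder
open Literature.AlgebraicGeometry.Motives Literature.NumberTheory.Automorphic Literature.NumberTheory.Automorphic.UnitaryGroup
open Literature.NumberTheory.Automorphic.Liu2021.AppendixC (C5.OpenCompactSubgroup C5.SmallLevel)

namespace Literature.AlgebraicGeometry.ShimuraVarieties.UnitaryCanonicalModel

variable {L : Type} [Field L] [NumberField L] [IsCMField L] {Jstar : Matrix (Fin 2) (Fin 2) L} {τ : L →+* ℂ}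
  {K₀ : C5.OpenCompactSubgroup ↥(finAdelic (↥(maximalRealSubfield L)) L (IsCMField.complexConj L) 2 Jstar)}
  {E : Type} [Field E] [Algebra L E] {τE : E →+* ℂ}

set_option maxHeartbeats 400000 in -- large adelic ∕ Shimura-set binder types (as ★ `UnitaryShimuraCurveWeakCanonicalUnique`)
/-- **The base change of a curve record is a weak record** ([Deligne1979ShimuraVarieties] 2.2.4–2.2.6): for `S : RecordSystemGS L J⋆ τ K₀`, a field
`E′` with `L → E′` and `τ′ : E′ → ℂ` extending `τ`, and a small level `K`, the `E′`-scheme `Y := M_K ⊗_L E′` has (i) a homeomorphism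
`ptsY : Y_{τ′}(ℂ) ≃ₜ Sh_K(U(J⋆), 𝔻)(ℂ)` (★ `exists_homeomorph_complexPoints_baseChange` then (F2a) `S.pts K`), (ii) Shimura reciprocity (62) at
the diagonal CM pairs for every `σ ∈ Aut(ℂ∕τ′E′)` with Artin correspondent `s` ((F3) `S.recip K` at `σ|_{τL}`, transported by ★
`smul_eq_of_left_comp_fst`), and (iii) an isomorphism `gY : Y ⊗_{τ′} ℂ ≅ M_K ⊗_τ ℂ` over `ℂ` carrying `bce_{τ′}(ptsY⁻¹[v,aK])` to
`bce_τ((S.pts K)⁻¹[v,aK])` (★ `exists_iso_baseChangeHom_baseChange`) — exactly the `Y`-side binders `ptsY`, `recipY` of ★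
`WeakRecordGS.exists_iso_of_complexIso` plus the bridge to `S`՚s complex fibre.
[cite: Deligne1979ShimuraVarieties, 2.2.4–2.2.6] [cite: Milne2005ShimuraVarieties, Def. 12.8 (62) p. 114; Thm. 13.7 p. 119] [cite: GortzWedhorn2020, Prop. 4.16] -/
theorem RecordSystemGS.exists_weakRecord_baseChange (S : RecordSystemGS L Jstar τ K₀) (hτ : τE.comp (algebraMap L E) = τ)
    (K : C5.SmallLevel K₀) :
    letI : Algebra E ℂ := τE.toAlgebra
    ∃ ptsY : ComplexPoints ((Motives.baseChange L E).obj (S.M.obj K)) ≃ₜ ShimuraSetGS L Jstar τ K.1.1,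
      (∀ (σ : ℂ ≃ₐ[E] ℂ) (s : (FiniteAdeleRing (𝓞 L) L)ˣ), IsArtinCorrespondent L τ s σ.toRingEquiv →
        ∀ (w : Fin 2 → L) (hw : (fun i => τ (w i)) ∈ negCone (Jstar.map τ))
          (d : ↥(finAdelic (↥(maximalRealSubfield L)) L (IsCMField.complexConj L) 2 Jstar)),
          IsDiagTwistGS L Jstar w (recipFactor L s) d →
          ∀ a : ↥(finAdelic (↥(maximalRealSubfield L)) L (IsCMField.complexConj L) 2 Jstar),
            σ • ptsY.symm (ShimuraSetGS.mk L Jstar τ K.1.1 (fun i => τ (w i)) hw a) =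
              ptsY.symm (ShimuraSetGS.mk L Jstar τ K.1.1 (fun i => τ (w i)) hw (d * a))) ∧
      ∃ gY : (Motives.baseChangeHom τE).obj ((Motives.baseChange L E).obj (S.M.obj K)) ≅ (Motives.baseChangeHom τ).obj (S.M.obj K),
        ∀ (v : Fin 2 → ℂ) (hv : v ∈ negCone (Jstar.map τ))
          (a : ↥(finAdelic (↥(maximalRealSubfield L)) L (IsCMField.complexConj L) 2 Jstar)),
          AlgPoints.map gY.hom (AlgPoints.baseChangeEquiv τE ((Motives.baseChange L E).obj (S.M.obj K))
              (ptsY.symm (ShimuraSetGS.mk L Jstar τ K.1.1 v hv a))) =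
            (letI : Algebra L ℂ := τ.toAlgebra
             AlgPoints.baseChangeEquiv τ (S.M.obj K) ((S.pts K).symm (ShimuraSetGS.mk L Jstar τ K.1.1 v hv a))) := by
  letI iE : Algebra E ℂ := τE.toAlgebra
  letI iL : Algebra L ℂ := τ.toAlgebra
  haveI : IsScalarTower L E ℂ := IsScalarTower.of_algebraMap_eq fun x => (RingHom.congr_fun hτ x).symm
  haveI : IsProper (S.M.obj K).hom := (S.projective K).isProper
  obtain ⟨e, he₁, -, -⟩ := Motives.exists_homeomorph_complexPoints_baseChange hτ (S.M.obj K)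
  obtain ⟨gY, -, -, hgY⟩ := Motives.exists_iso_baseChangeHom_baseChange hτ (S.M.obj K)
  refine ⟨e.trans (S.pts K), ?_, gY, fun v hv a => ?_⟩
  · intro σ s hs w hw d hd a
    -- reciprocity of `S` at `σ|_{τL}`, transported along the equivariant `e`
    have hs' : IsArtinCorrespondent L τ s (σ.restrictScalars L).toRingEquiv := hs
    have hrec := S.recip K (σ.restrictScalars L) s hs' w hw d hd a
    have hequiv := Motives.smul_eq_of_left_comp_fst hτ (S.M.obj K) e he₁ σ
      (e.symm ((S.pts K).symm (ShimuraSetGS.mk L Jstar τ K.1.1 (fun i => τ (w i)) hw a)))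
    rw [Homeomorph.apply_symm_apply] at hequiv
    change σ • e.symm ((S.pts K).symm _) = e.symm ((S.pts K).symm _)
    apply e.injective
    rw [hequiv, hrec, Homeomorph.apply_symm_apply]
  · change AlgPoints.map gY.hom (AlgPoints.baseChangeEquiv τE _ (e.symm ((S.pts K).symm _))) = _
    rw [hgY e he₁, Homeomorph.apply_symm_apply]

end Literature.AlgebraicGeometry.ShimuraVarieties.UnitaryCanonicalModel

end
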